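import Literature.MathematicalPhysics.QuantumFieldTheory.Balaban1983to89.B9Thm32CinvAtKnitLetterOfCubeData
import Literature.MathematicalPhysics.QuantumFieldTheory.Balaban1983to89.B9Ineq349WordDiffHom

/-!
# [B9] (3.25)–(3.26) at two transporter tables — the `Q′ ∕ (Q′G′²Q′*)⁻¹`-sector of the bond-sector junction at `(parSymY, parKnitY)` ((T) FILE 2c-ii)

T. Bałaban, *Propagators for lattice gauge theories in a background field*, Commun. Math. Phys. **99** (1985) 389–434
[`Balaban1985BackgroundPropagators`, "[B9]"]; T. Bałaban, *Propagators and renormalization transformations for lattice gauge theories. II*,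
Commun. Math. Phys. **96** (1984) 223–250 [`Balaban1984PropagatorsII`, "[4]"]; T. Bałaban, *Averaging operations for lattice gauge theories*,
Commun. Math. Phys. **98** (1985) 17–51 [`Balaban1985Averaging`, "[B7]"].  statement-level skeleton of published theorems with citation tags; proofs
where landed; nothing here is a claim about the Yang–Mills mass gap

THE PRINT (page owner r06).  (3.21) p. 394 (the block averages `Q′(U)`), (3.24)–(3.25) p. 394–395 («Rf = (I − G′Q′\*(Q′G′²Q′\*)⁻¹Q′G′)f»), (3.26) p. 395,
(3.19) p. 393 (the knit letter «(52), (53) in [5]») against def-Y's letter of record (print has ONE transporter convention — the junction is a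
formalisation artefact), Thm 3.1 (3.42) p. 397, Thm 3.2 (3.48) p. 398 («|(Q′G′²Q′\*)⁻¹(U; y, y′)| ≦ O(1)(Lʲη)⁻⁴exp(−δd(y,y′))»), (3.90) pp. 409–410,
(3.95) p. 411, (3.106) p. 414; [4] Prop. 2.2 (2.50)–(2.52) p. 232, Lemma 2.1 (2.60)–(2.61) p. 234, (2.66)–(2.67) p. 234; [B7] (17)–(20) pp. 20–21,
(52)–(53) pp. 26–27.

WHY THIS FILE (cell `lit-balaban`; seat t2s-1 gen 10; lead g34 RULING JUNCTION-PARS (T) CONFIRMED 2026-08-28T23:20Z; division t2s-1 ∕ p38 g46 of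
2026-08-29T00:11Z).  p38's FILE 2b `B9B8KnitBondWordDiff.hasMajorant_conj_DPDsY_sub` prices the junction `D_UP_SD*_U − D_UP_KD*_U` between def-Y's
letter of record `parSymY` (index 1) and print's knit letter `parKnitY` (index 2) from THIRTEEN member-level letter majorants; p38's 2c-i
(`B9B8KnitBondGpLettersAtPars`) supplies the four `G′`-entries.  THIS FILE supplies the other nine at `(parSymY, parKnitY)`, in 2b's hypothesis
shapes: the block-local letters `conĵQ′_j`, `conĵQ′*_j` (`κ_Q = M₂Σ‖b_j‖`, p21's `B9Thm39CinvSandwichQ`) and their differences (`θ_Q = 16(d+1)²α₀′M₂Σ‖b_j‖`,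
J-B 23a), and the three `C`-letters `conj b(η⁻⁴X_S⁻¹)`, `conj b(η⁻⁴X_K⁻¹)`, `conj b(η⁻⁴X_S⁻¹) − conj b(η⁻⁴X_K⁻¹)` (`X_j = Q′_jG′_j²Q′*_j`): the knit one is
J-B 23c's transfer of M5.6's (3.48) majorant through the fixed-point equation of [4] (2.66), the difference is [4] (2.50) `X_S⁻¹ − X_K⁻¹ = −X_K⁻¹(X_S − X_K)X_S⁻¹`
(23c `conj_fixedPoint_Xinv`) priced by p38's 2a `hasMajorant_cinvDiff` with J-B 23b's majorant of `η⁴(X_S − X_K)`; the block-diagonal letter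
`E = η⁻²(Δ′_S − Δ′_K) ≺ θ_E𝟙` and the knit-side (3.42)₁ majorant are DISCHARGED from def-Y's-side data by J-B file 9, so that only M5.5's
`conj b(η²G′_S) ≺ Aℓ²e^{−δ₀d}` and M5.6's `conj b(η⁻⁴X_S⁻¹) ≺ Kℓ⁻⁴e^{−δ₀d}` remain displayed, with the class (52), the basis data, the member's geometry
((2.54), `d(y,y) = 0`, scale transfers of `ℓ²`, `ℓ⁻⁴`, (2.61)∕(2.63) along 23c's rate ladder) and the two smallness windows of files 9 ∕ 23c located in `α₀′`.

WHAT THIS FILE PROVES (THEOREMS; 0 `def`, 0 `def … : Prop`, 0 sorry; standard axioms).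
* §1 `parSymY_bicontractive`, `parKnitY_bicontractive`; ★ `hasMajorantHom_conjHom_QpY_parSymY ∕ _parKnitY`, `hasMajorantHom_conjHom_QpsY_parSymY ∕ _parKnitY`
  (`≺ 𝟙·M₂Σ‖b_j‖`), ★ `hasMajorantHom_conjHom_QpY_sub_pars`, `hasMajorantHom_conjHom_QpsY_sub_pars` (`conĵQ′_S − conĵQ′_K ≺ 𝟙·16(d+1)²α₀′M₂Σ‖b_j‖`, 2b's shape).
* §2 (pointer only) the block-diagonal letter `conj b(η⁻²(Δ′_S − Δ′_K)) ≺ θ_E𝟙`, `θ_E = 32(d+1)²α₀′M₂Σ‖b_j‖` is p33's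
  `B9Thm32CinvAtKnitLetterOfCubeData.hasMajorant_conj_smul_sub_print` (used by name).
* §3 ★★ `hasMajorant_conj_XinvY_parKnitY_of_data` — 23c's ★★★ with `hE`, `hGk` discharged: from `hGs` (rate `δ₀`, constant `A`), `hT₀` (rate `δ₀`, constant `K`),
  file 9's window `θ_EAc₁(d_g,δ₀,α_g) < 1`, a base rate `δ ≤ (1−α_g)δ₀` and 23c's ladder `δ₁ = (1−α′)(1−α_st)δ`, `δ₂ = (1−α′)(1−α_st)δ₁`, `δ₃ = (1−α′)(1−α_st)δ₂`:
  `conj b(η⁻⁴X_K⁻¹) ≺ K_K·(ℓ(a)⁴)⁻¹·e^{−(1−α)δ₃d}`, `K_K = Kc₁(d₄,δ₃,α)(1 − θ_FKC₄c₁(d₃,(1−α_st)δ₂,α′)c₁(d₄,δ₃,α))⁻¹`, `θ_F` = 23b's constant at `(A, A_K, θ_E)`.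
* §4 ★★ `hasMajorant_conj_XinvY_sub_pars_of_majorants` — GENERIC: `C_S, C_K ≺ B₁ℓ⁻⁴e^{−δd}`, `F = conj b(η⁴(X_S − X_K)) ≺ θ_Fℓ⁴e^{−δd}`, (2.54), (2.61) at `β`,
  the transfer of `ℓ⁻⁴` at `α` (`Λ ≥ 1`), `ρ + 2(α+β)δ₀ ≤ δ` ⟹ `C_S − C_K ≺ (B₁²θ_FΛc₁²)·(ℓ(a)⁴)⁻¹·e^{−ρd}` (23c `conj_fixedPoint_Xinv` + 2a `hasMajorant_cinvDiff` + `−`).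
* §5 ★★★ `cLetters_pars_of_data` — the three `C`-inputs of 2b AT ONE RATE `ρ` and ONE constant `B₁ = max K K_K`: `conj b(η⁻⁴X_S⁻¹) ≺ B₁ℓ⁻⁴e^{−ρd}`,
  `conj b(η⁻⁴X_K⁻¹) ≺ B₁ℓ⁻⁴e^{−ρd}`, `conj b(η⁻⁴X_S⁻¹) − conj b(η⁻⁴X_K⁻¹) ≺ (B₁²θ_F′Λc₁²)ℓ⁻⁴e^{−ρd}` (`θ_F′` = 23b's constant), from the displayed def-Y's-side
  data, the class (52), the geometry and the windows; `η⁻⁴` spelled `(etaS i ^ 2 * etaS i ^ 2)⁻¹` (23c's convention; 2b's `((kGeo i).eta ^ 4)⁻¹` is the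
  same number under `hcf` — the assembler 2c-iii rewrites).

HONEST SCOPE ∕ NOT CLAIMED.  Bookkeeping over landed letters (p21 SandwichQ, J-B 9 ∕ 23a ∕ 23b ∕ 23c, p38 2a); block-majorant (operator) form; `𝔸 = M_N(ℂ)`,
`N ≥ 1`, any `G ≤ U(N)` averaging-closed.  The def-Y's-side data `hGs`, `hT₀` are HYPOTHESES (M5.5 ∕ M5.6 output shapes; their suppliers are p33's lineage),
as are the geometry facts and the smallness windows.  Print has one transporter convention; the junction is a formalisation artefact.  NOT a node
discharge; no summit ∕ sub-problem statement is proved; nothing continuum ∕ OS ∕ mass-gap ∕ Clay; YM mass gap NOT proved by any of this (Track A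
conditional rung).  No `sorry`, no `axiom`, no `… : Prop` fact, no `instance`, no `notation`, no `def`.  NEW file; nothing landed is modified.
`--supports stmt-QuantumFields-19200` as helper.  Net new unproved facts: 0.

RELATED IN THE TREE, NOT DUPLICATED (searched 2026-08-29: `rg 'QpY_sub_pars|XinvY_sub_pars|cLetters_pars' Literature/` = ∅; the gate's dedup pointed §2 to p33's
`hasMajorant_conj_smul_sub_print`, now used by name; p33's `B9Thm32CinvAtKnitLetterOfCubeData.cinv_at_knit_member_of_cubeData_unitary` is the ∃-threshold
FROM-CUBE-DATA form of §3 — a different statement (here: member-level displayed data, the currency of FILE 4's binder)): J-B 23a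
`B9B8KnitLetterQpDiff.hasMajorantHom_conjHom_QpY_sym_sub_knit` (USED BY NAME; §1 only re-brackets `conĵ(A − B) = conĵA − conĵB`), J-B 23c
`B9B8KnitLetterCinvTransfer.hasMajorant_conj_XinvY_parKnitY_of_letters` (USED BY NAME; §3 discharges two of its letters), p38 2a
`B9Ineq349WordDiffHom.hasMajorant_cinvDiff` (USED BY NAME), p38 2c-i `B9B8KnitBondGpLettersAtPars.hasMajorant_conj_E` (the `K − S` orientation of §2's letter;
in flight, not imported).
-/

noncomputable section

namespace Literature.MathematicalPhysics.QuantumFieldTheory.Balaban1983to89.B9B8KnitBondCLettersAtPars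

open Node00
open B6Geom246MultiLevelBox (blkOf)
open B6KLevelCensusIndexV1 (KIdx)
open B6RandomWalk (HasMajorant Triangle254 Ineq261 Ineq263 hasMajorant_mono c1_nonneg)
open B6RandomWalkHom (HasMajorantHom)
open B9Thm34Ext (toB6)
open B9GeoNormsKLevelV1 (geo9K geo9K_dist_nonneg)
open B9GeoLemma21KLevelV1 (geo9K_len_pos)
open B9Ineq347 (ScaleTransfer)
open B9Eq352DivFormLetters (conj)
open B9Eq376POneLetters (conjHom conjHom_sub)
open B9Cor35GpCubeInputsAtOne (hasMajorant_neg)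
open B9Ineq349WordDiffHom (hasMajorant_cinvDiff)
open B9Thm39CinvSandwichQ (hasMajorantHom_conjHom_QpY hasMajorantHom_conjHom_QpsY)
open B9B8KnitLetterQpDiff (hasMajorantHom_conjHom_QpY_sym_sub_knit hasMajorantHom_conjHom_QpsY_sym_sub_knit)
open B9B8KnitLetterMajorantTransfer (hasMajorant_conj_GpY_parKnitY_of_parSymY_len)
open B9B8KnitLetterXDiffMajorant (hasMajorant_rate_mono rate_le hasMajorant_conj_XY_sym_sub_knit)
open B9B8KnitLetterCinvTransfer (conj_fixedPoint_Xinv hasMajorant_conj_XinvY_parKnitY_of_letters)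
open B9Thm32CinvAtKnitLetterOfCubeData (hasMajorant_conj_smul_sub_print)
open B7Prop1Explicit (mem_U1)
open B7Prop2Explicit (AvgClosed pdev C0 c2' unitaryUnits unitaryUnits_le_U1)
open B9B8CarrierDictionary (liftCfg)
open B9B8AveragingJunction (parKnitY)
open B9B8KnitLetterRegular (parKnitY_mem_of_pdev)
open B9Ineq349SiteComposite (etaS_pos)
open scoped Matrix Matrix.Norms.L2Operator

variable {d ℓ : ℕ} {hd : 1 ≤ d + 1} {hL : Odd (ℓ + 1) ∧ 1 < ℓ + 1} {b₀ b₁ : ℝ}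
variable (i : KIdx d ℓ hd hL b₀ b₁) {N : ℕ} {G : Subgroup (Matrix (Fin N) (Fin N) ℂ)ˣ}
variable {ι : Type} [Fintype ι] [DecidableEq ι] (b : Module.Basis ι ℝ (Matrix (Fin N) (Fin N) ℂ))
variable [Fintype (geo9K i).Site] [DecidableEq (geo9K i).Site] {Rr : ℝ} {Hp : Prop} (ιB : BlkY i → IBondY i)

/-! ## §1  The block-local letters `conĵQ′_j`, `conĵQ′*_j` at the two tables and their differences -/

section QLetters

omit [Fintype ι] [DecidableEq ι] [Fintype (geo9K i).Site] [DecidableEq (geo9K i).Site] in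
/-- the legs of def-Y's letter `parSymY` at a `G`-valued `U`, `G ≤ U(N)`, are contraction pairs. [cite: Balaban1985BackgroundPropagators, (3.21) p.394, p.389 («G ⊂ U(N)»)] -/
theorem parSymY_bicontractive [Nonempty (Fin N)] (hG : G ≤ unitaryUnits (Matrix (Fin N) (Fin N) ℂ)) {U : CfgY (Matrix (Fin N) (Fin N) ℂ) i}
    (hU : ∀ μ x, U μ x ∈ G) (z w : SiteY i) :
    ‖(parSymY i U z w : Matrix (Fin N) (Fin N) ℂ)‖ ≤ 1 ∧
      ‖(((parSymY i U z w)⁻¹ : (Matrix (Fin N) (Fin N) ℂ)ˣ) : Matrix (Fin N) (Fin N) ℂ)‖ ≤ 1 := by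
  letI : CStarAlgebra (Matrix (Fin N) (Fin N) ℂ) := {}
  exact mem_U1.1 (unitaryUnits_le_U1 (hG (parSymY_mem i hU z w)))

omit [Fintype ι] [DecidableEq ι] [Fintype (geo9K i).Site] [DecidableEq (geo9K i).Site] in
/-- the legs of print's knit letter `parKnitY` at a `G`-valued `U` on the class (52), `G ≤ U(N)` averaging-closed, are contraction pairs (J-B 4b: the knit legs
are `G`-valued). [cite: Balaban1985BackgroundPropagators, (3.19) p.393; Balaban1985Averaging, (52)–(53) pp.26–27] -/
theorem parKnitY_bicontractive [Nonempty (Fin N)] (hG : G ≤ unitaryUnits (Matrix (Fin N) (Fin N) ℂ)) (hGa : AvgClosed (d + 1) (ℓ + 1) G)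
    {U : CfgY (Matrix (Fin N) (Fin N) ℂ) i} (hU : ∀ μ x, U μ x ∈ G) {α₀' : ℝ} (hα : 0 < α₀') (hα3 : C0 (d + 1) * α₀' ≤ 1 / 3)
    (hα2 : 2 * α₀' ≤ c2' (d + 1) (ℓ + 1)) (h52 : pdev (liftCfg U) < α₀' * ((((ℓ + 1 : ℕ) : ℝ) ^ i.k)⁻¹) ^ 2) (z w : SiteY i) :
    ‖(parKnitY i U z w : Matrix (Fin N) (Fin N) ℂ)‖ ≤ 1 ∧
      ‖(((parKnitY i U z w)⁻¹ : (Matrix (Fin N) (Fin N) ℂ)ˣ) : Matrix (Fin N) (Fin N) ℂ)‖ ≤ 1 := by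
  letI : CStarAlgebra (Matrix (Fin N) (Fin N) ℂ) := {}
  exact mem_U1.1 (unitaryUnits_le_U1 (hG (parKnitY_mem_of_pdev i hGa hU hα hα3 hα2 h52 z w)))

omit [DecidableEq ι] in
/-- ★ `conĵQ′(U; parSymY) ≺ 𝟙[a = a′]·M₂Σ_j‖b_j‖` (site carrier → block carrier) — 2b's `hQ₁`. [cite: Balaban1985BackgroundPropagators, (3.21) p.394, (3.42) p.397; Balaban1984PropagatorsII, (2.51) p.232, (2.14) p.225] -/
theorem hasMajorantHom_conjHom_QpY_parSymY [Nonempty (Fin N)] (hG : G ≤ unitaryUnits (Matrix (Fin N) (Fin N) ℂ)) {U : CfgY (Matrix (Fin N) (Fin N) ℂ) i}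
    (hU : ∀ μ x, U μ x ∈ G) {M₂ : ℝ} (hM₂ : 0 ≤ M₂) (hrepr : ∀ (v : Matrix (Fin N) (Fin N) ℂ) (j : ι), |b.repr v j| ≤ M₂ * ‖v‖) :
    HasMajorantHom (g := toB6 (geo9K i) Rr Hp) (fun p : SiteY i × ι => ιB (blkOf i.D.toDomains p.1)) (fun q : BlkY i × ι => ιB q.1)
      (conjHom b ((QpY i (parSymY i) U).restrictScalars ℝ)) (fun a a' : (geo9K i).Site => if a = a' then M₂ * ∑ j, ‖b j‖ else 0) :=
  hasMajorantHom_conjHom_QpY i b ιB (parSymY i) U (parSymY_bicontractive i hG hU) hM₂ hrepr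

omit [DecidableEq ι] in
/-- ★ `conĵQ′(U; parKnitY) ≺ 𝟙[a = a′]·M₂Σ_j‖b_j‖` — 2b's `hQ₂`. [cite: Balaban1985BackgroundPropagators, (3.21) p.394, (3.19) p.393, (3.42) p.397; Balaban1984PropagatorsII, (2.51) p.232; Balaban1985Averaging, (52)–(53) pp.26–27] -/
theorem hasMajorantHom_conjHom_QpY_parKnitY [Nonempty (Fin N)] (hG : G ≤ unitaryUnits (Matrix (Fin N) (Fin N) ℂ)) (hGa : AvgClosed (d + 1) (ℓ + 1) G)
    {U : CfgY (Matrix (Fin N) (Fin N) ℂ) i} (hU : ∀ μ x, U μ x ∈ G) {α₀' : ℝ} (hα : 0 < α₀') (hα3 : C0 (d + 1) * α₀' ≤ 1 / 3)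
    (hα2 : 2 * α₀' ≤ c2' (d + 1) (ℓ + 1)) (h52 : pdev (liftCfg U) < α₀' * ((((ℓ + 1 : ℕ) : ℝ) ^ i.k)⁻¹) ^ 2)
    {M₂ : ℝ} (hM₂ : 0 ≤ M₂) (hrepr : ∀ (v : Matrix (Fin N) (Fin N) ℂ) (j : ι), |b.repr v j| ≤ M₂ * ‖v‖) :
    HasMajorantHom (g := toB6 (geo9K i) Rr Hp) (fun p : SiteY i × ι => ιB (blkOf i.D.toDomains p.1)) (fun q : BlkY i × ι => ιB q.1)
      (conjHom b ((QpY i (parKnitY i) U).restrictScalars ℝ)) (fun a a' : (geo9K i).Site => if a = a' then M₂ * ∑ j, ‖b j‖ else 0) :=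
  hasMajorantHom_conjHom_QpY i b ιB (parKnitY i) U (parKnitY_bicontractive i hG hGa hU hα hα3 hα2 h52) hM₂ hrepr

omit [DecidableEq ι] in
/-- ★ `conĵQ′*(U; parSymY) ≺ 𝟙[a = a′]·M₂Σ_j‖b_j‖` (block carrier → site carrier) — 2b's `hQs₁`. [cite: Balaban1985BackgroundPropagators, (3.24)–(3.25) p.394–395, (3.42) p.397; Balaban1984PropagatorsII, (2.51) p.232, (2.16) p.225] -/
theorem hasMajorantHom_conjHom_QpsY_parSymY [Nonempty (Fin N)] (hG : G ≤ unitaryUnits (Matrix (Fin N) (Fin N) ℂ)) {U : CfgY (Matrix (Fin N) (Fin N) ℂ) i}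
    (hU : ∀ μ x, U μ x ∈ G) {M₂ : ℝ} (hM₂ : 0 ≤ M₂) (hrepr : ∀ (v : Matrix (Fin N) (Fin N) ℂ) (j : ι), |b.repr v j| ≤ M₂ * ‖v‖) :
    HasMajorantHom (g := toB6 (geo9K i) Rr Hp) (fun q : BlkY i × ι => ιB q.1) (fun p : SiteY i × ι => ιB (blkOf i.D.toDomains p.1))
      (conjHom b ((QpsY i (parSymY i) U).restrictScalars ℝ)) (fun a a' : (geo9K i).Site => if a = a' then M₂ * ∑ j, ‖b j‖ else 0) :=
  hasMajorantHom_conjHom_QpsY i b ιB (parSymY i) U (parSymY_bicontractive i hG hU) hM₂ hrepr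

omit [DecidableEq ι] in
/-- ★ `conĵQ′*(U; parKnitY) ≺ 𝟙[a = a′]·M₂Σ_j‖b_j‖` — 2b's `hQs₂`. [cite: Balaban1985BackgroundPropagators, (3.24)–(3.25) p.394–395, (3.19) p.393; Balaban1984PropagatorsII, (2.51) p.232; Balaban1985Averaging, (52)–(53) pp.26–27] -/
theorem hasMajorantHom_conjHom_QpsY_parKnitY [Nonempty (Fin N)] (hG : G ≤ unitaryUnits (Matrix (Fin N) (Fin N) ℂ)) (hGa : AvgClosed (d + 1) (ℓ + 1) G)
    {U : CfgY (Matrix (Fin N) (Fin N) ℂ) i} (hU : ∀ μ x, U μ x ∈ G) {α₀' : ℝ} (hα : 0 < α₀') (hα3 : C0 (d + 1) * α₀' ≤ 1 / 3)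
    (hα2 : 2 * α₀' ≤ c2' (d + 1) (ℓ + 1)) (h52 : pdev (liftCfg U) < α₀' * ((((ℓ + 1 : ℕ) : ℝ) ^ i.k)⁻¹) ^ 2)
    {M₂ : ℝ} (hM₂ : 0 ≤ M₂) (hrepr : ∀ (v : Matrix (Fin N) (Fin N) ℂ) (j : ι), |b.repr v j| ≤ M₂ * ‖v‖) :
    HasMajorantHom (g := toB6 (geo9K i) Rr Hp) (fun q : BlkY i × ι => ιB q.1) (fun p : SiteY i × ι => ιB (blkOf i.D.toDomains p.1))
      (conjHom b ((QpsY i (parKnitY i) U).restrictScalars ℝ)) (fun a a' : (geo9K i).Site => if a = a' then M₂ * ∑ j, ‖b j‖ else 0) :=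
  hasMajorantHom_conjHom_QpsY i b ιB (parKnitY i) U (parKnitY_bicontractive i hG hGa hU hα hα3 hα2 h52) hM₂ hrepr

omit [DecidableEq ι] in
/-- ★ `conĵQ′(U; parSymY) − conĵQ′(U; parKnitY) ≺ 𝟙[a = a′]·16(d+1)²α₀′·M₂Σ_j‖b_j‖` — J-B 23a in 2b's shape `hdQ` (`conĵ(A − B) = conĵA − conĵB`).
[cite: Balaban1985BackgroundPropagators, (3.21) p.394, (3.19) p.393, (3.42) p.397; Balaban1984PropagatorsII, (2.51) p.232; Balaban1985Averaging, (17)–(20) pp.20–21, (52)–(53) pp.26–27] -/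
theorem hasMajorantHom_conjHom_QpY_sub_pars [Nonempty (Fin N)] (hG : G ≤ unitaryUnits (Matrix (Fin N) (Fin N) ℂ)) (hGa : AvgClosed (d + 1) (ℓ + 1) G)
    {U : CfgY (Matrix (Fin N) (Fin N) ℂ) i} (hU : ∀ μ x, U μ x ∈ G) {α₀' : ℝ} (hα : 0 < α₀') (hα3 : C0 (d + 1) * α₀' ≤ 1 / 3)
    (hα2 : 2 * α₀' ≤ c2' (d + 1) (ℓ + 1)) (h52 : pdev (liftCfg U) < α₀' * ((((ℓ + 1 : ℕ) : ℝ) ^ i.k)⁻¹) ^ 2)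
    {M₂ : ℝ} (hM₂ : 0 ≤ M₂) (hrepr : ∀ (v : Matrix (Fin N) (Fin N) ℂ) (j : ι), |b.repr v j| ≤ M₂ * ‖v‖) :
    HasMajorantHom (g := toB6 (geo9K i) Rr Hp) (fun p : SiteY i × ι => ιB (blkOf i.D.toDomains p.1)) (fun q : BlkY i × ι => ιB q.1)
      (conjHom b ((QpY i (parSymY i) U).restrictScalars ℝ) - conjHom b ((QpY i (parKnitY i) U).restrictScalars ℝ))
      (fun a a' : (geo9K i).Site => if a = a' then 2 * (8 * ((d : ℝ) + 1) ^ 2 * α₀') * (M₂ * ∑ j, ‖b j‖) else 0) := by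
  rw [← conjHom_sub]
  exact hasMajorantHom_conjHom_QpY_sym_sub_knit i b ιB hG hGa hU hα hα3 hα2 h52 hM₂ hrepr

omit [DecidableEq ι] in
/-- ★ `conĵQ′*(U; parSymY) − conĵQ′*(U; parKnitY) ≺ 𝟙[a = a′]·16(d+1)²α₀′·M₂Σ_j‖b_j‖` — J-B 23a in 2b's shape `hdQs`.
[cite: Balaban1985BackgroundPropagators, (3.24)–(3.25) p.394–395, (3.19) p.393; Balaban1984PropagatorsII, (2.51) p.232; Balaban1985Averaging, (17)–(20) pp.20–21, (52)–(53) pp.26–27] -/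
theorem hasMajorantHom_conjHom_QpsY_sub_pars [Nonempty (Fin N)] (hG : G ≤ unitaryUnits (Matrix (Fin N) (Fin N) ℂ)) (hGa : AvgClosed (d + 1) (ℓ + 1) G)
    {U : CfgY (Matrix (Fin N) (Fin N) ℂ) i} (hU : ∀ μ x, U μ x ∈ G) {α₀' : ℝ} (hα : 0 < α₀') (hα3 : C0 (d + 1) * α₀' ≤ 1 / 3)
    (hα2 : 2 * α₀' ≤ c2' (d + 1) (ℓ + 1)) (h52 : pdev (liftCfg U) < α₀' * ((((ℓ + 1 : ℕ) : ℝ) ^ i.k)⁻¹) ^ 2)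
    {M₂ : ℝ} (hM₂ : 0 ≤ M₂) (hrepr : ∀ (v : Matrix (Fin N) (Fin N) ℂ) (j : ι), |b.repr v j| ≤ M₂ * ‖v‖) :
    HasMajorantHom (g := toB6 (geo9K i) Rr Hp) (fun q : BlkY i × ι => ιB q.1) (fun p : SiteY i × ι => ιB (blkOf i.D.toDomains p.1))
      (conjHom b ((QpsY i (parSymY i) U).restrictScalars ℝ) - conjHom b ((QpsY i (parKnitY i) U).restrictScalars ℝ))
      (fun a a' : (geo9K i).Site => if a = a' then 2 * (8 * ((d : ℝ) + 1) ^ 2 * α₀') * (M₂ * ∑ j, ‖b j‖) else 0) := by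
  rw [← conjHom_sub]
  exact hasMajorantHom_conjHom_QpsY_sym_sub_knit i b ιB hG hGa hU hα hα3 hα2 h52 hM₂ hrepr

end QLetters

/-! ## §2  The block-diagonal letter `E = η⁻²(Δ′_S − Δ′_K) ≺ θ_E𝟙`, `θ_E = 32(d+1)²α₀′M₂Σ‖b_j‖`, in the orientation of 23b ∕ 23c IS p33's
`B9Thm32CinvAtKnitLetterOfCubeData.hasMajorant_conj_smul_sub_print` (file 9 §1 in print's units) — USED BY NAME below, not restated. -/

/-! ## §3  ★★ (3.48) at the knit letter from def-Y's-side data (23c with `hE`, `hGk` discharged by file 9) -/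

section CKnit

/-- ★★ **[B9] THM 3.2 (3.48) AT PRINT's KNIT LETTER FROM def-Y's-SIDE DATA.**  `G ≤ U(N)` averaging-closed, `N ≥ 1`, a `G`-valued `U` on [B7]'s class (52),
print's units `c_f = L^k`, a real basis with coordinate bound `M₂`; DISPLAYED at the rate `δ₀`: M5.5's (3.42)₁ majorant `A·ℓ²·e^{−δ₀d}` of `conj b(η²G′(U; parSymY))`
and M5.6's (3.48) majorant `K·(ℓ⁴)⁻¹·e^{−δ₀d}` of `conj b(η⁻⁴X(U; parSymY)⁻¹)`; file 9's window `θ_EAc₁(d_g,δ₀,α_g) < 1` (`θ_E = 32(d+1)²α₀′M₂Σ‖b_j‖`) with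
(2.61)∕(2.63) at `(δ₀, α_g)`; a base rate `δ ≤ (1−α_g)δ₀` carrying 23c's ladder `δ₁ = (1−α′)(1−α_st)δ`, `δ₂ = (1−α′)(1−α_st)δ₁`, `δ₃ = (1−α′)(1−α_st)δ₂` (scale
transfers of `ℓ²` at `δ`, `δ₁` (constant `C`) and of `ℓ⁻⁴` at `δ₂` (constant `C₄`), (2.61) at `((1−α_st)δ, α′)`, `((1−α_st)δ₁, α′)`, `((1−α_st)δ₂, α′)`, (2.61)∕(2.63)
at `(δ₃, α)`) and 23c's window `θ_FKC₄c₁((1−α_st)δ₂,α′)c₁(δ₃,α) < 1`, `θ_F` = 23b's constant at `(A, A_K, θ_E)`, `A_K = Ac₁(d_g,δ₀,α_g)(1 − θ_EAc₁(d_g,δ₀,α_g))⁻¹`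
(file 9's knit-side (3.42)₁ constant).  THEN `conj b(η⁻⁴X(U; parKnitY)⁻¹) ≺ Kc₁(d₄,δ₃,α)(1 − θ_FKC₄c₁c₁(d₄,δ₃,α))⁻¹·(ℓ(a)⁴)⁻¹·e^{−(1−α)δ₃d(a,a′)}` on `(s, j) ↦ ιB s`.
[cite: Balaban1985BackgroundPropagators, Thm 3.2 (3.48) p.398, Thm 3.1 (3.42) p.397, (3.19) p.393, (3.25) p.395, (3.90) pp.409–410, (3.95) p.411; Balaban1984PropagatorsII, (2.50)–(2.52) p.232, (2.60)–(2.61) p.234, (2.66)–(2.67) p.234; Balaban1985Averaging, (52)–(53) pp.26–27] -/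
theorem hasMajorant_conj_XinvY_parKnitY_of_data [Nonempty (Fin N)] (hG : G ≤ unitaryUnits (Matrix (Fin N) (Fin N) ℂ)) (hGa : AvgClosed (d + 1) (ℓ + 1) G)
    {U : CfgY (Matrix (Fin N) (Fin N) ℂ) i} (hU : ∀ μ x, U μ x ∈ G) {α₀' : ℝ} (hα : 0 < α₀') (hα3 : C0 (d + 1) * α₀' ≤ 1 / 3)
    (hα2 : 2 * α₀' ≤ c2' (d + 1) (ℓ + 1)) (h52 : pdev (liftCfg U) < α₀' * ((((ℓ + 1 : ℕ) : ℝ) ^ i.k)⁻¹) ^ 2)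
    (hcf : i.cf = (((ℓ + 1 : ℕ) : ℝ)) ^ i.k)
    {M₂ : ℝ} (hM₂ : 0 ≤ M₂) (hrepr : ∀ (v : Matrix (Fin N) (Fin N) ℂ) (j : ι), |b.repr v j| ≤ M₂ * ‖v‖)
    -- def-Y's-side data and file 9's window
    (dg : ℕ) {δ₀ αg A K : ℝ} (hA : 0 ≤ A) (hK : 0 ≤ K) (hαδg : 0 ≤ (1 - αg) * δ₀) (hαδg' : 0 ≤ αg * δ₀)
    (htri : Triangle254 (toB6 (geo9K i) Rr Hp)) (hrefl : ∀ y : (geo9K i).Site, (geo9K i).dist y y = 0)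
    (h261g : Ineq261 dg (toB6 (geo9K i) Rr Hp) δ₀ αg) (h263g : Ineq263 dg (toB6 (geo9K i) Rr Hp) δ₀ αg)
    {θE AK : ℝ} (hθE : θE = 32 * ((d : ℝ) + 1) ^ 2 * α₀' * (M₂ * ∑ j, ‖b j‖))
    (hAK : AK = A * B6.c1 dg δ₀ αg * (1 - θE * A * B6.c1 dg δ₀ αg)⁻¹) (hsmallg : θE * A * B6.c1 dg δ₀ αg < 1)
    (hGs : HasMajorant (g := toB6 (geo9K i) Rr Hp) (fun p : SiteY i × ι => ιB (blkOf i.D.toDomains p.1))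
      (conj b ((etaS i ^ 2) • (GpY i (parSymY i) U).restrictScalars ℝ)) (fun a a' => A * (geo9K i).len a ^ 2 * Real.exp (-(δ₀ * (geo9K i).dist a a'))))
    (hT₀ : HasMajorant (g := toB6 (geo9K i) Rr Hp) (fun q : BlkY i × ι => ιB q.1)
      (conj b ((etaS i ^ 2 * etaS i ^ 2)⁻¹ • (XinvY i (parSymY i) (GpY i (parSymY i)) U).restrictScalars ℝ))
      (fun a a' => K * ((geo9K i).len a ^ 4)⁻¹ * Real.exp (-(δ₀ * (geo9K i).dist a a'))))
    -- 23c's ladder on a base rate `δ ≤ (1−α_g)δ₀`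
    (d₁ d₂ d₃ d₄ : ℕ) {δ δ₁ δ₂ δ₃ αst α' α C C₄ : ℝ} (hδ : δ ≤ (1 - αg) * δ₀)
    (hδ₁ : δ₁ = (1 - α') * ((1 - αst) * δ)) (hδ₂ : δ₂ = (1 - α') * ((1 - αst) * δ₁)) (hδ₃ : δ₃ = (1 - α') * ((1 - αst) * δ₂))
    (hC : 0 ≤ C) (hC₄ : 0 ≤ C₄) (hαδ : 0 ≤ αst * δ) (hα'0 : 0 ≤ α') (hα'1 : α' ≤ 1) (hδ' : 0 ≤ (1 - αst) * δ)
    (hαδ₂ : 0 ≤ αst * δ₁) (hδ'₂ : 0 ≤ (1 - αst) * δ₁) (hαδ₃ : 0 ≤ αst * δ₂) (hδ'₃ : 0 ≤ (1 - αst) * δ₂) (hαδ₄ : 0 ≤ (1 - α) * δ₃)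
    (hST : ScaleTransfer (geo9K i) δ αst C (fun a => (geo9K i).len a ^ 2))
    (h261 : Ineq261 d₁ (toB6 (geo9K i) Rr Hp) ((1 - αst) * δ) α')
    (hST₂ : ScaleTransfer (geo9K i) δ₁ αst C (fun a => (geo9K i).len a ^ 2))
    (h261₂ : Ineq261 d₂ (toB6 (geo9K i) Rr Hp) ((1 - αst) * δ₁) α')
    (hST₃ : ScaleTransfer (geo9K i) δ₂ αst C₄ (fun a => ((geo9K i).len a ^ 4)⁻¹))
    (h261₃ : Ineq261 d₃ (toB6 (geo9K i) Rr Hp) ((1 - αst) * δ₂) α')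
    (h261₄ : Ineq261 d₄ (toB6 (geo9K i) Rr Hp) δ₃ α) (h263₄ : Ineq263 d₄ (toB6 (geo9K i) Rr Hp) δ₃ α)
    {θF : ℝ} (hθF : θF = (2 * (8 * ((d : ℝ) + 1) ^ 2 * α₀') * (M₂ * ∑ j, ‖b j‖)) * (M₂ * ∑ j, ‖b j‖) * (A * A * C * B6.c1 d₁ ((1 - αst) * δ) α') +
          (M₂ * ∑ j, ‖b j‖) * (M₂ * ∑ j, ‖b j‖) * ((A + AK) * (AK * (θE * A) * C * B6.c1 d₁ ((1 - αst) * δ) α') * C * B6.c1 d₂ ((1 - αst) * δ₁) α') +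
          (M₂ * ∑ j, ‖b j‖) * ((2 * (8 * ((d : ℝ) + 1) ^ 2 * α₀') * (M₂ * ∑ j, ‖b j‖))) * (AK * AK * C * B6.c1 d₁ ((1 - αst) * δ) α'))
    (hsmall : θF * K * C₄ * B6.c1 d₃ ((1 - αst) * δ₂) α' * B6.c1 d₄ δ₃ α < 1) :
    HasMajorant (g := toB6 (geo9K i) Rr Hp) (fun q : BlkY i × ι => ιB q.1)
      (conj b ((etaS i ^ 2 * etaS i ^ 2)⁻¹ • (XinvY i (parKnitY i) (GpY i (parKnitY i)) U).restrictScalars ℝ))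
      (fun a a' => K * B6.c1 d₄ δ₃ α * (1 - θF * K * C₄ * B6.c1 d₃ ((1 - αst) * δ₂) α' * B6.c1 d₄ δ₃ α)⁻¹ * ((geo9K i).len a ^ 4)⁻¹ *
        Real.exp (-((1 - α) * δ₃ * (geo9K i).dist a a'))) := by
  subst hθF hδ₃ hδ₂ hδ₁ hAK hθE
  have hdnn : ∀ y y' : (geo9K i).Site, 0 ≤ (geo9K i).dist y y' := geo9K_dist_nonneg i
  have hSb : 0 ≤ ∑ j, ‖b j‖ := Finset.sum_nonneg fun _ _ => norm_nonneg _
  have hθE0 : 0 ≤ 32 * ((d : ℝ) + 1) ^ 2 * α₀' * (M₂ * ∑ j, ‖b j‖) := mul_nonneg (by positivity) (mul_nonneg hM₂ hSb)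
  have hcg : 0 ≤ B6.c1 dg δ₀ αg := c1_nonneg dg δ₀ αg
  have hAK0 : 0 ≤ A * B6.c1 dg δ₀ αg * (1 - 32 * ((d : ℝ) + 1) ^ 2 * α₀' * (M₂ * ∑ j, ‖b j‖) * A * B6.c1 dg δ₀ αg)⁻¹ :=
    mul_nonneg (mul_nonneg hA hcg) (inv_nonneg.2 (sub_nonneg.2 hsmallg.le))
  -- `δ ≤ (1−α_g)δ₀ ≤ δ₀`
  have hδδ₀ : δ ≤ δ₀ := hδ.trans (by linarith only [hαδg'])
  -- the block-diagonal letter and the knit-side (3.42)₁ majorant from def-Y's side (file 9)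
  have hE := hasMajorant_conj_smul_sub_print b i ιB (Rr := Rr) (Hp := Hp) hG hGa hU hα hα3 hα2 h52 hM₂ hrepr
  have hGk := hasMajorant_conj_GpY_parKnitY_of_parSymY_len i b ιB (Rr := Rr) (Hp := Hp) hG hGa hU hα hα3 hα2 h52 hcf hM₂ hrepr dg hA hαδg htri
    hrefl hdnn h261g h263g hsmallg hGs
  -- the three data at the base rate `δ`
  have hGs' := hasMajorant_rate_mono i (Rr := Rr) (Hp := Hp) (fun p : SiteY i × ι => ιB (blkOf i.D.toDomains p.1))
    (fun a => (geo9K i).len a ^ 2) hA (fun a => sq_nonneg _) hδδ₀ hGs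
  have hGk' := hasMajorant_rate_mono i (Rr := Rr) (Hp := Hp) (fun p : SiteY i × ι => ιB (blkOf i.D.toDomains p.1))
    (fun a => (geo9K i).len a ^ 2) hAK0 (fun a => sq_nonneg _) hδ hGk
  have hT₀' := hasMajorant_rate_mono i (Rr := Rr) (Hp := Hp) (fun q : BlkY i × ι => ιB q.1) (fun a => ((geo9K i).len a ^ 4)⁻¹) hK
    (fun a => inv_nonneg.2 (pow_nonneg (geo9K_len_pos i a).le 4)) hδδ₀ hT₀
  exact hasMajorant_conj_XinvY_parKnitY_of_letters i b ιB hG hGa hU hα hα3 hα2 h52 hcf hM₂ hrepr d₁ d₂ d₃ d₄ hA hAK0 hθE0 hK hC hC₄ hαδ hα'0 hα'1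
    hδ' hαδ₂ hδ'₂ hαδ₃ hδ'₃ hαδ₄ htri hrefl hdnn hST h261 hST₂ h261₂ hST₃ h261₃ h261₄ h263₄ hsmall hE hGs' hGk' hT₀'

end CKnit

/-! ## §4  ★★ The difference `conj b(η⁻⁴X_S⁻¹) − conj b(η⁻⁴X_K⁻¹)` from three majorants ([4] (2.50) + p38's 2a) -/

section CDiff

omit [DecidableEq ι] [DecidableEq (geo9K i).Site] in
/-- ★★ **THE DIFFERENCE OF THE TWO `C`-LETTERS, GENERIC.**  For `G ≤ U(N)`, a `G`-valued `U` whose knit legs are `G`-valued (so that both `X_S`, `X_K` are units: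
p21's `isUnit_XY_parSymY`, J-B 13's `isUnit_XY_parKnitY`), [4] (2.50) reads `η⁻⁴X_S⁻¹ − η⁻⁴X_K⁻¹ = −(η⁻⁴X_K⁻¹)·(η⁴(X_S − X_K))·(η⁻⁴X_S⁻¹)` (23c
`conj_fixedPoint_Xinv`); with `C_S, C_K ≺ B₁(ℓ⁴)⁻¹e^{−δd}`, `F = conj b(η⁴(X_S − X_K)) ≺ θ_Fℓ⁴e^{−δd}` on the block carrier, (2.54), (2.61) at `(δ₀, β)`, the
transfer of `ℓ⁻⁴` at `(δ₀, α, Λ)`, `Λ ≥ 1`, `ρ + 2(α+β)δ₀ ≤ δ`, p38's 2a `hasMajorant_cinvDiff` prices the triple product: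
`conj b(η⁻⁴X_S⁻¹) − conj b(η⁻⁴X_K⁻¹) ≺ (B₁²θ_FΛc₁(d₅,δ₀,β)²)·(ℓ(a)⁴)⁻¹·e^{−ρd(a,a′)}` — 2b's `hdC` shape.
[cite: Balaban1984PropagatorsII, Prop. 2.2 (2.50)–(2.52) p.232, Lemma 2.1 (2.60)–(2.61) p.234; Balaban1985BackgroundPropagators, (3.25) p.395, Thm 3.2 (3.48) p.398, (3.90) p.409, (3.95) p.411] -/
theorem hasMajorant_conj_XinvY_sub_pars_of_majorants (hG : G ≤ unitaryUnits (Matrix (Fin N) (Fin N) ℂ)) {U : CfgY (Matrix (Fin N) (Fin N) ℂ) i}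
    (hU : ∀ μ x, U μ x ∈ G) (hparK : ∀ z w : SiteY i, parKnitY i U z w ∈ G)
    (d₅ : ℕ) (δ₀ δ α β ρ Λ B₁ θF : ℝ) (hB₁ : 0 ≤ B₁) (hθF : 0 ≤ θF) (hΛ : 1 ≤ Λ) (hρ : 0 ≤ ρ) (hα : 0 ≤ α) (hβ : 0 ≤ β) (hδ₀ : 0 ≤ δ₀)
    (hr : ρ + 2 * (α + β) * δ₀ ≤ δ) (htri : Triangle254 (toB6 (geo9K i) Rr Hp))
    (h261 : Ineq261 d₅ (toB6 (geo9K i) Rr Hp) δ₀ β) (hT4 : ScaleTransfer (geo9K i) δ₀ α Λ (fun a => ((geo9K i).len a ^ 4)⁻¹))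
    (hCS : HasMajorant (g := toB6 (geo9K i) Rr Hp) (fun q : BlkY i × ι => ιB q.1)
      (conj b ((etaS i ^ 2 * etaS i ^ 2)⁻¹ • (XinvY i (parSymY i) (GpY i (parSymY i)) U).restrictScalars ℝ))
      (fun a a' => B₁ * ((geo9K i).len a ^ 4)⁻¹ * Real.exp (-(δ * (geo9K i).dist a a'))))
    (hCK : HasMajorant (g := toB6 (geo9K i) Rr Hp) (fun q : BlkY i × ι => ιB q.1)
      (conj b ((etaS i ^ 2 * etaS i ^ 2)⁻¹ • (XinvY i (parKnitY i) (GpY i (parKnitY i)) U).restrictScalars ℝ))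
      (fun a a' => B₁ * ((geo9K i).len a ^ 4)⁻¹ * Real.exp (-(δ * (geo9K i).dist a a'))))
    (hF : HasMajorant (g := toB6 (geo9K i) Rr Hp) (fun q : BlkY i × ι => ιB q.1)
      (conj b ((etaS i ^ 2 * etaS i ^ 2) • ((XY i (parSymY i) (GpY i (parSymY i)) U).restrictScalars ℝ -
        (XY i (parKnitY i) (GpY i (parKnitY i)) U).restrictScalars ℝ)))
      (fun a a' => θF * (geo9K i).len a ^ 4 * Real.exp (-(δ * (geo9K i).dist a a')))) :
    HasMajorant (g := toB6 (geo9K i) Rr Hp) (fun q : BlkY i × ι => ιB q.1)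
      (conj b ((etaS i ^ 2 * etaS i ^ 2)⁻¹ • (XinvY i (parSymY i) (GpY i (parSymY i)) U).restrictScalars ℝ) -
        conj b ((etaS i ^ 2 * etaS i ^ 2)⁻¹ • (XinvY i (parKnitY i) (GpY i (parKnitY i)) U).restrictScalars ℝ))
      (fun a a' => (B₁ * B₁ * θF * Λ * B6.c1 d₅ δ₀ β ^ 2) * ((geo9K i).len a ^ 4)⁻¹ * Real.exp (-(ρ * (geo9K i).dist a a'))) := by
  have hs : etaS i ^ 2 * etaS i ^ 2 ≠ 0 := by positivity [etaS_pos i]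
  set CS : Module.End ℝ (BlkY i × ι → ℝ) :=
    conj b ((etaS i ^ 2 * etaS i ^ 2)⁻¹ • (XinvY i (parSymY i) (GpY i (parSymY i)) U).restrictScalars ℝ) with hCSdef
  set CK : Module.End ℝ (BlkY i × ι → ℝ) :=
    conj b ((etaS i ^ 2 * etaS i ^ 2)⁻¹ • (XinvY i (parKnitY i) (GpY i (parKnitY i)) U).restrictScalars ℝ) with hCKdef
  set F : Module.End ℝ (BlkY i × ι → ℝ) := conj b ((etaS i ^ 2 * etaS i ^ 2) • ((XY i (parSymY i) (GpY i (parSymY i)) U).restrictScalars ℝ -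
    (XY i (parKnitY i) (GpY i (parKnitY i)) U).restrictScalars ℝ)) with hFdef
  -- [4] (2.50): `C_K = C_S + C_K·F·C_S`, hence `C_S − C_K = −(C_K ∘ F ∘ C_S)`
  have hfix : CK = CS + CK * (F * CS) := conj_fixedPoint_Xinv i b hG hU hparK hs
  have e : CS - CK = -(CK ∘ₗ F ∘ₗ CS) := by
    rw [← Module.End.mul_eq_comp, ← Module.End.mul_eq_comp]
    calc CS - CK = CS - (CS + CK * (F * CS)) := by rw [← hfix]
      _ = -(CK * (F * CS)) := by abel
  rw [e]
  exact hasMajorant_neg (g := toB6 (geo9K i) Rr Hp) _ (hasMajorant_cinvDiff (R := Rr) (H := Hp) (fun q : BlkY i × ι => ιB q.1) d₅ δ₀ δ α β ρ Λ B₁ θF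
    hB₁ hθF hΛ hρ hα hβ hδ₀ hr (geo9K_dist_nonneg i) htri (geo9K_len_pos i) h261 hT4 hCS hCK hF)

end CDiff

/-! ## §5  ★★★ The three `C`-inputs of FILE 2b at one rate and one constant, from def-Y's-side data -/

section CLetters

/-- ★★★ **THE `(Q′G′²Q′*)⁻¹`-SECTOR OF THE JUNCTION AT `(parSymY, parKnitY)`.**  Under the hypotheses of `hasMajorant_conj_XinvY_parKnitY_of_data` (class (52),
`c_f = L^k`, basis data, def-Y's-side data `hGs` ∕ `hT₀` at the rate `δ₀`, file 9's window, 23c's ladder `δ ≥ δ₁ ≥ δ₂ ≥ δ₃` with its window), `0 ≤ α`, and ONE more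
Lemma 2.1 for the difference ((2.61) at `(δ₅, β₅)`, the transfer of `ℓ⁻⁴` at `(δ₅, α₅, Λ₄)`, `Λ₄ ≥ 1`, `ρ + 2(α₅+β₅)δ₅ ≤ (1−α)δ₃`): with `B₁ = max K K_K`,
`K_K = Kc₁(d₄,δ₃,α)(1 − θ_FKC₄c₁((1−α_st)δ₂,α′)c₁(d₄,δ₃,α))⁻¹`, all three `C`-inputs of 2b's `hasMajorant_conj_DPDsY_sub` hold AT THE RATE `ρ`:
`conj b(η⁻⁴X_S⁻¹) ≺ B₁(ℓ⁴)⁻¹e^{−ρd}`, `conj b(η⁻⁴X_K⁻¹) ≺ B₁(ℓ⁴)⁻¹e^{−ρd}`, `conj b(η⁻⁴X_S⁻¹) − conj b(η⁻⁴X_K⁻¹) ≺ (B₁²θ_FΛ₄c₁(d₅,δ₅,β₅)²)(ℓ⁴)⁻¹e^{−ρd}` — `θ_F = O(α₀′)`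
(each of its three summands carries `α₀′` through `2·8(d+1)²α₀′` or `θ_E`).
[cite: Balaban1985BackgroundPropagators, Thm 3.2 (3.48) p.398, (3.25) p.395, (3.19) p.393, (3.90) pp.409–410, (3.95) p.411; Balaban1984PropagatorsII, Prop. 2.2 (2.50)–(2.52) p.232, Lemma 2.1 (2.60)–(2.61) p.234, (2.66)–(2.67) p.234; Balaban1985Averaging, (52)–(53) pp.26–27] -/
theorem cLetters_pars_of_data [Nonempty (Fin N)] (hG : G ≤ unitaryUnits (Matrix (Fin N) (Fin N) ℂ)) (hGa : AvgClosed (d + 1) (ℓ + 1) G)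
    {U : CfgY (Matrix (Fin N) (Fin N) ℂ) i} (hU : ∀ μ x, U μ x ∈ G) {α₀' : ℝ} (hα : 0 < α₀') (hα3 : C0 (d + 1) * α₀' ≤ 1 / 3)
    (hα2 : 2 * α₀' ≤ c2' (d + 1) (ℓ + 1)) (h52 : pdev (liftCfg U) < α₀' * ((((ℓ + 1 : ℕ) : ℝ) ^ i.k)⁻¹) ^ 2)
    (hcf : i.cf = (((ℓ + 1 : ℕ) : ℝ)) ^ i.k)
    {M₂ : ℝ} (hM₂ : 0 ≤ M₂) (hrepr : ∀ (v : Matrix (Fin N) (Fin N) ℂ) (j : ι), |b.repr v j| ≤ M₂ * ‖v‖)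
    -- def-Y's-side data and file 9's window
    (dg : ℕ) {δ₀ αg A K : ℝ} (hA : 0 ≤ A) (hK : 0 ≤ K) (hαδg : 0 ≤ (1 - αg) * δ₀) (hαδg' : 0 ≤ αg * δ₀)
    (htri : Triangle254 (toB6 (geo9K i) Rr Hp)) (hrefl : ∀ y : (geo9K i).Site, (geo9K i).dist y y = 0)
    (h261g : Ineq261 dg (toB6 (geo9K i) Rr Hp) δ₀ αg) (h263g : Ineq263 dg (toB6 (geo9K i) Rr Hp) δ₀ αg)
    {θE AK : ℝ} (hθE : θE = 32 * ((d : ℝ) + 1) ^ 2 * α₀' * (M₂ * ∑ j, ‖b j‖))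
    (hAK : AK = A * B6.c1 dg δ₀ αg * (1 - θE * A * B6.c1 dg δ₀ αg)⁻¹) (hsmallg : θE * A * B6.c1 dg δ₀ αg < 1)
    (hGs : HasMajorant (g := toB6 (geo9K i) Rr Hp) (fun p : SiteY i × ι => ιB (blkOf i.D.toDomains p.1))
      (conj b ((etaS i ^ 2) • (GpY i (parSymY i) U).restrictScalars ℝ)) (fun a a' => A * (geo9K i).len a ^ 2 * Real.exp (-(δ₀ * (geo9K i).dist a a'))))
    (hT₀ : HasMajorant (g := toB6 (geo9K i) Rr Hp) (fun q : BlkY i × ι => ιB q.1)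
      (conj b ((etaS i ^ 2 * etaS i ^ 2)⁻¹ • (XinvY i (parSymY i) (GpY i (parSymY i)) U).restrictScalars ℝ))
      (fun a a' => K * ((geo9K i).len a ^ 4)⁻¹ * Real.exp (-(δ₀ * (geo9K i).dist a a'))))
    -- 23c's ladder on a base rate `δ ≤ (1−α_g)δ₀`
    (d₁ d₂ d₃ d₄ : ℕ) {δ δ₁ δ₂ δ₃ αst α' α C C₄ : ℝ} (hδ : δ ≤ (1 - αg) * δ₀)
    (hδ₁ : δ₁ = (1 - α') * ((1 - αst) * δ)) (hδ₂ : δ₂ = (1 - α') * ((1 - αst) * δ₁)) (hδ₃ : δ₃ = (1 - α') * ((1 - αst) * δ₂))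
    (hC : 0 ≤ C) (hC₄ : 0 ≤ C₄) (hαδ : 0 ≤ αst * δ) (hα'0 : 0 ≤ α') (hα'1 : α' ≤ 1) (hδ' : 0 ≤ (1 - αst) * δ)
    (hαδ₂ : 0 ≤ αst * δ₁) (hδ'₂ : 0 ≤ (1 - αst) * δ₁) (hαδ₃ : 0 ≤ αst * δ₂) (hδ'₃ : 0 ≤ (1 - αst) * δ₂) (hα0 : 0 ≤ α) (hαδ₄ : 0 ≤ (1 - α) * δ₃)
    (hST : ScaleTransfer (geo9K i) δ αst C (fun a => (geo9K i).len a ^ 2))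
    (h261 : Ineq261 d₁ (toB6 (geo9K i) Rr Hp) ((1 - αst) * δ) α')
    (hST₂ : ScaleTransfer (geo9K i) δ₁ αst C (fun a => (geo9K i).len a ^ 2))
    (h261₂ : Ineq261 d₂ (toB6 (geo9K i) Rr Hp) ((1 - αst) * δ₁) α')
    (hST₃ : ScaleTransfer (geo9K i) δ₂ αst C₄ (fun a => ((geo9K i).len a ^ 4)⁻¹))
    (h261₃ : Ineq261 d₃ (toB6 (geo9K i) Rr Hp) ((1 - αst) * δ₂) α')
    (h261₄ : Ineq261 d₄ (toB6 (geo9K i) Rr Hp) δ₃ α) (h263₄ : Ineq263 d₄ (toB6 (geo9K i) Rr Hp) δ₃ α)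
    {θF : ℝ} (hθF : θF = (2 * (8 * ((d : ℝ) + 1) ^ 2 * α₀') * (M₂ * ∑ j, ‖b j‖)) * (M₂ * ∑ j, ‖b j‖) * (A * A * C * B6.c1 d₁ ((1 - αst) * δ) α') +
          (M₂ * ∑ j, ‖b j‖) * (M₂ * ∑ j, ‖b j‖) * ((A + AK) * (AK * (θE * A) * C * B6.c1 d₁ ((1 - αst) * δ) α') * C * B6.c1 d₂ ((1 - αst) * δ₁) α') +
          (M₂ * ∑ j, ‖b j‖) * ((2 * (8 * ((d : ℝ) + 1) ^ 2 * α₀') * (M₂ * ∑ j, ‖b j‖))) * (AK * AK * C * B6.c1 d₁ ((1 - αst) * δ) α'))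
    (hsmall : θF * K * C₄ * B6.c1 d₃ ((1 - αst) * δ₂) α' * B6.c1 d₄ δ₃ α < 1)
    {KK : ℝ} (hKK : KK = K * B6.c1 d₄ δ₃ α * (1 - θF * K * C₄ * B6.c1 d₃ ((1 - αst) * δ₂) α' * B6.c1 d₄ δ₃ α)⁻¹)
    -- the difference's Lemma 2.1
    (d₅ : ℕ) {δ₅ α₅ β₅ ρ Λ₄ : ℝ} (hΛ₄ : 1 ≤ Λ₄) (hρ : 0 ≤ ρ) (hα₅ : 0 ≤ α₅) (hβ₅ : 0 ≤ β₅) (hδ₅ : 0 ≤ δ₅)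
    (hr₅ : ρ + 2 * (α₅ + β₅) * δ₅ ≤ (1 - α) * δ₃) (h261₅ : Ineq261 d₅ (toB6 (geo9K i) Rr Hp) δ₅ β₅)
    (hT4₅ : ScaleTransfer (geo9K i) δ₅ α₅ Λ₄ (fun a => ((geo9K i).len a ^ 4)⁻¹)) :
    HasMajorant (g := toB6 (geo9K i) Rr Hp) (fun q : BlkY i × ι => ιB q.1)
        (conj b ((etaS i ^ 2 * etaS i ^ 2)⁻¹ • (XinvY i (parSymY i) (GpY i (parSymY i)) U).restrictScalars ℝ))
        (fun a a' => max K KK * ((geo9K i).len a ^ 4)⁻¹ * Real.exp (-(ρ * (geo9K i).dist a a'))) ∧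
      HasMajorant (g := toB6 (geo9K i) Rr Hp) (fun q : BlkY i × ι => ιB q.1)
        (conj b ((etaS i ^ 2 * etaS i ^ 2)⁻¹ • (XinvY i (parKnitY i) (GpY i (parKnitY i)) U).restrictScalars ℝ))
        (fun a a' => max K KK * ((geo9K i).len a ^ 4)⁻¹ * Real.exp (-(ρ * (geo9K i).dist a a'))) ∧
      HasMajorant (g := toB6 (geo9K i) Rr Hp) (fun q : BlkY i × ι => ιB q.1)
        (conj b ((etaS i ^ 2 * etaS i ^ 2)⁻¹ • (XinvY i (parSymY i) (GpY i (parSymY i)) U).restrictScalars ℝ) -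
          conj b ((etaS i ^ 2 * etaS i ^ 2)⁻¹ • (XinvY i (parKnitY i) (GpY i (parKnitY i)) U).restrictScalars ℝ))
        (fun a a' => (max K KK * max K KK * θF * Λ₄ * B6.c1 d₅ δ₅ β₅ ^ 2) * ((geo9K i).len a ^ 4)⁻¹ * Real.exp (-(ρ * (geo9K i).dist a a'))) := by
  -- §3 at the knit letter (rate `(1−α)δ₃`, constant `K_K`)
  have hCK := hasMajorant_conj_XinvY_parKnitY_of_data i b ιB (Rr := Rr) (Hp := Hp) hG hGa hU hα hα3 hα2 h52 hcf hM₂ hrepr dg hA hK hαδg hαδg' htri hrefl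
    h261g h263g hθE hAK hsmallg hGs hT₀ d₁ d₂ d₃ d₄ hδ hδ₁ hδ₂ hδ₃ hC hC₄ hαδ hα'0 hα'1 hδ' hαδ₂ hδ'₂ hαδ₃ hδ'₃ hαδ₄ hST h261 hST₂ h261₂ hST₃ h261₃
    h261₄ h263₄ hθF hsmall
  subst hKK hθF hδ₃ hδ₂ hδ₁ hAK hθE
  have hdnn : ∀ y y' : (geo9K i).Site, 0 ≤ (geo9K i).dist y y' := geo9K_dist_nonneg i
  have hparK : ∀ z w : SiteY i, parKnitY i U z w ∈ G := fun z w => parKnitY_mem_of_pdev i hGa hU hα hα3 hα2 h52 z w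
  have hSb : 0 ≤ ∑ j, ‖b j‖ := Finset.sum_nonneg fun _ _ => norm_nonneg _
  have hθE0 : 0 ≤ 32 * ((d : ℝ) + 1) ^ 2 * α₀' * (M₂ * ∑ j, ‖b j‖) := mul_nonneg (by positivity) (mul_nonneg hM₂ hSb)
  have hcg : 0 ≤ B6.c1 dg δ₀ αg := c1_nonneg dg δ₀ αg
  have hAK0 : 0 ≤ A * B6.c1 dg δ₀ αg * (1 - 32 * ((d : ℝ) + 1) ^ 2 * α₀' * (M₂ * ∑ j, ‖b j‖) * A * B6.c1 dg δ₀ αg)⁻¹ :=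
    mul_nonneg (mul_nonneg hA hcg) (inv_nonneg.2 (sub_nonneg.2 hsmallg.le))
  have hc₁ := c1_nonneg d₁ ((1 - αst) * δ) α'
  have hc₂ := c1_nonneg d₂ ((1 - αst) * ((1 - α') * ((1 - αst) * δ))) α'
  have hc₃ := c1_nonneg d₃ ((1 - αst) * ((1 - α') * ((1 - αst) * ((1 - α') * ((1 - αst) * δ))))) α'
  have hc₄ := c1_nonneg d₄ ((1 - α') * ((1 - αst) * ((1 - α') * ((1 - αst) * ((1 - α') * ((1 - αst) * δ)))))) α
  have hθF0 : 0 ≤ (2 * (8 * ((d : ℝ) + 1) ^ 2 * α₀') * (M₂ * ∑ j, ‖b j‖)) * (M₂ * ∑ j, ‖b j‖) * (A * A * C * B6.c1 d₁ ((1 - αst) * δ) α') +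
      (M₂ * ∑ j, ‖b j‖) * (M₂ * ∑ j, ‖b j‖) *
        ((A + A * B6.c1 dg δ₀ αg * (1 - 32 * ((d : ℝ) + 1) ^ 2 * α₀' * (M₂ * ∑ j, ‖b j‖) * A * B6.c1 dg δ₀ αg)⁻¹) *
          (A * B6.c1 dg δ₀ αg * (1 - 32 * ((d : ℝ) + 1) ^ 2 * α₀' * (M₂ * ∑ j, ‖b j‖) * A * B6.c1 dg δ₀ αg)⁻¹ *
            (32 * ((d : ℝ) + 1) ^ 2 * α₀' * (M₂ * ∑ j, ‖b j‖) * A) * C * B6.c1 d₁ ((1 - αst) * δ) α') * C *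
          B6.c1 d₂ ((1 - αst) * ((1 - α') * ((1 - αst) * δ))) α') +
      (M₂ * ∑ j, ‖b j‖) * ((2 * (8 * ((d : ℝ) + 1) ^ 2 * α₀') * (M₂ * ∑ j, ‖b j‖))) *
        (A * B6.c1 dg δ₀ αg * (1 - 32 * ((d : ℝ) + 1) ^ 2 * α₀' * (M₂ * ∑ j, ‖b j‖) * A * B6.c1 dg δ₀ αg)⁻¹ *
          (A * B6.c1 dg δ₀ αg * (1 - 32 * ((d : ℝ) + 1) ^ 2 * α₀' * (M₂ * ∑ j, ‖b j‖) * A * B6.c1 dg δ₀ αg)⁻¹) * C * B6.c1 d₁ ((1 - αst) * δ) α') := by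
    positivity
  have hKK0 : 0 ≤ K * B6.c1 d₄ ((1 - α') * ((1 - αst) * ((1 - α') * ((1 - αst) * ((1 - α') * ((1 - αst) * δ)))))) α *
      (1 - ((2 * (8 * ((d : ℝ) + 1) ^ 2 * α₀') * (M₂ * ∑ j, ‖b j‖)) * (M₂ * ∑ j, ‖b j‖) * (A * A * C * B6.c1 d₁ ((1 - αst) * δ) α') +
          (M₂ * ∑ j, ‖b j‖) * (M₂ * ∑ j, ‖b j‖) *
            ((A + A * B6.c1 dg δ₀ αg * (1 - 32 * ((d : ℝ) + 1) ^ 2 * α₀' * (M₂ * ∑ j, ‖b j‖) * A * B6.c1 dg δ₀ αg)⁻¹) *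
              (A * B6.c1 dg δ₀ αg * (1 - 32 * ((d : ℝ) + 1) ^ 2 * α₀' * (M₂ * ∑ j, ‖b j‖) * A * B6.c1 dg δ₀ αg)⁻¹ *
                (32 * ((d : ℝ) + 1) ^ 2 * α₀' * (M₂ * ∑ j, ‖b j‖) * A) * C * B6.c1 d₁ ((1 - αst) * δ) α') * C *
              B6.c1 d₂ ((1 - αst) * ((1 - α') * ((1 - αst) * δ))) α') +
          (M₂ * ∑ j, ‖b j‖) * ((2 * (8 * ((d : ℝ) + 1) ^ 2 * α₀') * (M₂ * ∑ j, ‖b j‖))) *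
            (A * B6.c1 dg δ₀ αg * (1 - 32 * ((d : ℝ) + 1) ^ 2 * α₀' * (M₂ * ∑ j, ‖b j‖) * A * B6.c1 dg δ₀ αg)⁻¹ *
              (A * B6.c1 dg δ₀ αg * (1 - 32 * ((d : ℝ) + 1) ^ 2 * α₀' * (M₂ * ∑ j, ‖b j‖) * A * B6.c1 dg δ₀ αg)⁻¹) * C * B6.c1 d₁ ((1 - αst) * δ) α')) * K * C₄ *
        B6.c1 d₃ ((1 - αst) * ((1 - α') * ((1 - αst) * ((1 - α') * ((1 - αst) * δ))))) α' *
        B6.c1 d₄ ((1 - α') * ((1 - αst) * ((1 - α') * ((1 - αst) * ((1 - α') * ((1 - αst) * δ)))))) α)⁻¹ :=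
    mul_nonneg (mul_nonneg hK hc₄) (inv_nonneg.2 (sub_nonneg.2 hsmall.le))
  -- the rate chain `ρ ≤ (1−α)δ₃ ≤ δ₃ ≤ δ₂ ≤ δ₁ ≤ δ ≤ δ₀`
  have hδδ₀ : δ ≤ δ₀ := hδ.trans (by linarith only [hαδg'])
  have h1 : (1 - α') * ((1 - αst) * δ) ≤ δ := rate_le hαδ hα'0 hδ'
  have h2 : (1 - α') * ((1 - αst) * ((1 - α') * ((1 - αst) * δ))) ≤ (1 - α') * ((1 - αst) * δ) := rate_le hαδ₂ hα'0 hδ'₂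
  have h3 : (1 - α') * ((1 - αst) * ((1 - α') * ((1 - αst) * ((1 - α') * ((1 - αst) * δ))))) ≤
      (1 - α') * ((1 - αst) * ((1 - α') * ((1 - αst) * δ))) := rate_le hαδ₃ hα'0 hδ'₃
  have hδ₃0 : 0 ≤ (1 - α') * ((1 - αst) * ((1 - α') * ((1 - αst) * ((1 - α') * ((1 - αst) * δ))))) := mul_nonneg (sub_nonneg.2 hα'1) hδ'₃
  have h4 : (1 - α) * ((1 - α') * ((1 - αst) * ((1 - α') * ((1 - αst) * ((1 - α') * ((1 - αst) * δ)))))) ≤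
      (1 - α') * ((1 - αst) * ((1 - α') * ((1 - αst) * ((1 - α') * ((1 - αst) * δ))))) := by linarith only [mul_nonneg hα0 hδ₃0]
  have h5 : 0 ≤ 2 * (α₅ + β₅) * δ₅ := by positivity
  have hρc : ρ ≤ (1 - α) * ((1 - α') * ((1 - αst) * ((1 - α') * ((1 - αst) * ((1 - α') * ((1 - αst) * δ)))))) := by linarith only [hr₅, h5]
  have hcS : (1 - α) * ((1 - α') * ((1 - αst) * ((1 - α') * ((1 - αst) * ((1 - α') * ((1 - αst) * δ)))))) ≤ δ₀ := by
    linarith only [h4, h3, h2, h1, hδδ₀]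
  have hcF : (1 - α) * ((1 - α') * ((1 - αst) * ((1 - α') * ((1 - αst) * ((1 - α') * ((1 - αst) * δ)))))) ≤
      (1 - α') * ((1 - αst) * ((1 - α') * ((1 - αst) * δ))) := by linarith only [h4, h3]
  -- the block-diagonal letter and the two (3.42)₁ majorants at the base rate `δ` (file 9), then 23b's `F` at `δ₂`
  have hE := hasMajorant_conj_smul_sub_print b i ιB (Rr := Rr) (Hp := Hp) hG hGa hU hα hα3 hα2 h52 hM₂ hrepr
  have hGk := hasMajorant_conj_GpY_parKnitY_of_parSymY_len i b ιB (Rr := Rr) (Hp := Hp) hG hGa hU hα hα3 hα2 h52 hcf hM₂ hrepr dg hA hαδg htri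
    hrefl hdnn h261g h263g hsmallg hGs
  have hGs' := hasMajorant_rate_mono i (Rr := Rr) (Hp := Hp) (fun p : SiteY i × ι => ιB (blkOf i.D.toDomains p.1))
    (fun a => (geo9K i).len a ^ 2) hA (fun a => sq_nonneg _) hδδ₀ hGs
  have hGk' := hasMajorant_rate_mono i (Rr := Rr) (Hp := Hp) (fun p : SiteY i × ι => ιB (blkOf i.D.toDomains p.1))
    (fun a => (geo9K i).len a ^ 2) hAK0 (fun a => sq_nonneg _) hδ hGk
  have hF := hasMajorant_conj_XY_sym_sub_knit i b ιB (Rr := Rr) (Hp := Hp) hG hGa hU hα hα3 hα2 h52 hcf hM₂ hrepr d₁ d₂ hA hAK0 hθE0 hC hαδ hα'0 hα'1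
    hδ' hαδ₂ hδ'₂ htri hdnn hST h261 hST₂ h261₂ hE hGs' hGk'
  have hw4 : ∀ a : (geo9K i).Site, 0 ≤ ((geo9K i).len a ^ 4)⁻¹ := fun a => inv_nonneg.2 (pow_nonneg (geo9K_len_pos i a).le 4)
  have hw4' : ∀ a : (geo9K i).Site, 0 ≤ (geo9K i).len a ^ 4 := fun a => pow_nonneg (geo9K_len_pos i a).le 4
  have hF' := hasMajorant_rate_mono i (Rr := Rr) (Hp := Hp) (fun q : BlkY i × ι => ιB q.1) (fun a => (geo9K i).len a ^ 4) hθF0 hw4' hcF hF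
  -- the two `C`-letters at the common constant `max K K_K` and the common rate `(1−α)δ₃`
  have hKM := le_max_left K (K * B6.c1 d₄ ((1 - α') * ((1 - αst) * ((1 - α') * ((1 - αst) * ((1 - α') * ((1 - αst) * δ)))))) α *
      (1 - ((2 * (8 * ((d : ℝ) + 1) ^ 2 * α₀') * (M₂ * ∑ j, ‖b j‖)) * (M₂ * ∑ j, ‖b j‖) * (A * A * C * B6.c1 d₁ ((1 - αst) * δ) α') +
          (M₂ * ∑ j, ‖b j‖) * (M₂ * ∑ j, ‖b j‖) *
            ((A + A * B6.c1 dg δ₀ αg * (1 - 32 * ((d : ℝ) + 1) ^ 2 * α₀' * (M₂ * ∑ j, ‖b j‖) * A * B6.c1 dg δ₀ αg)⁻¹) *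
              (A * B6.c1 dg δ₀ αg * (1 - 32 * ((d : ℝ) + 1) ^ 2 * α₀' * (M₂ * ∑ j, ‖b j‖) * A * B6.c1 dg δ₀ αg)⁻¹ *
                (32 * ((d : ℝ) + 1) ^ 2 * α₀' * (M₂ * ∑ j, ‖b j‖) * A) * C * B6.c1 d₁ ((1 - αst) * δ) α') * C *
              B6.c1 d₂ ((1 - αst) * ((1 - α') * ((1 - αst) * δ))) α') +
          (M₂ * ∑ j, ‖b j‖) * ((2 * (8 * ((d : ℝ) + 1) ^ 2 * α₀') * (M₂ * ∑ j, ‖b j‖))) *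
            (A * B6.c1 dg δ₀ αg * (1 - 32 * ((d : ℝ) + 1) ^ 2 * α₀' * (M₂ * ∑ j, ‖b j‖) * A * B6.c1 dg δ₀ αg)⁻¹ *
              (A * B6.c1 dg δ₀ αg * (1 - 32 * ((d : ℝ) + 1) ^ 2 * α₀' * (M₂ * ∑ j, ‖b j‖) * A * B6.c1 dg δ₀ αg)⁻¹) * C * B6.c1 d₁ ((1 - αst) * δ) α')) * K * C₄ *
        B6.c1 d₃ ((1 - αst) * ((1 - α') * ((1 - αst) * ((1 - α') * ((1 - αst) * δ))))) α' *
        B6.c1 d₄ ((1 - α') * ((1 - αst) * ((1 - α') * ((1 - αst) * ((1 - α') * ((1 - αst) * δ)))))) α)⁻¹)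
  have hM0 := hK.trans hKM
  have hCS' := hasMajorant_mono (g := toB6 (geo9K i) Rr Hp) _
    (hasMajorant_rate_mono i (Rr := Rr) (Hp := Hp) (fun q : BlkY i × ι => ιB q.1) (fun a => ((geo9K i).len a ^ 4)⁻¹) hK hw4 hcS hT₀)
    fun a a' => mul_le_mul_of_nonneg_right (mul_le_mul_of_nonneg_right hKM (hw4 a)) (Real.exp_nonneg _)
  have hCK' := hasMajorant_mono (g := toB6 (geo9K i) Rr Hp) _ hCK
    fun a a' => mul_le_mul_of_nonneg_right (mul_le_mul_of_nonneg_right (le_max_right K _) (hw4 a)) (Real.exp_nonneg _)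
  -- §4 on the triple product, and the two `C`-letters at the rate `ρ`
  have hdC := hasMajorant_conj_XinvY_sub_pars_of_majorants i b ιB (Rr := Rr) (Hp := Hp) hG hU hparK d₅ δ₅ _ α₅ β₅ ρ Λ₄ _ _ hM0 hθF0 hΛ₄ hρ hα₅ hβ₅
    hδ₅ hr₅ htri h261₅ hT4₅ hCS' hCK' hF'
  exact ⟨hasMajorant_rate_mono i (Rr := Rr) (Hp := Hp) (fun q : BlkY i × ι => ιB q.1) (fun a => ((geo9K i).len a ^ 4)⁻¹) hM0 hw4 hρc hCS',
    hasMajorant_rate_mono i (Rr := Rr) (Hp := Hp) (fun q : BlkY i × ι => ιB q.1) (fun a => ((geo9K i).len a ^ 4)⁻¹) hM0 hw4 hρc hCK', hdC⟩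

end CLetters

end Literature.MathematicalPhysics.QuantumFieldTheory.Balaban1983to89.B9B8KnitBondCLettersAtPars

end
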